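import Literature.MathematicalPhysics.QuantumFieldTheory.Borinsky2020.ConvergenceTheorem
import HarnessLib

/-!
# Borinsky's convergence theorem (AIHPD 2023 = arXiv:2008.12310, Theorem 3) in POINTWISE (ray) form: if the support-function difference `Γ(y) = max_ℬ⟨y,·⟩ − max_𝒜⟨y,·⟩` is positive in every direction `y ∉ ℝ𝟙`, then — by homogeneity and compactness — the uniform gap `Γ(y) ≥ ε‖y‖_{ℝⁿ/𝟙ℝ}` of Lemma 15 holds, hence (with R3) the integral converges absolutely — PROVED

independent recomputation; certified where stated, statistical where stated; no new-physics claim.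

CITATION HEADER (venture `QEDPrecision`, cell `qed-hepp` (HOME `run/shared/lean/pub/qed-hepp/`), literature seat `qed-hepp-lit` gen 7;
VALUE-FREE: statements about ABSTRACT polynomials and one parametric integral form — no Feynman graph, no Monte-Carlo value, nothing per
word or per Set-V family). Companion of `ConvergenceTheorem.lean` (pub-qed trop-lit gen 25: Theorem 3 from R1 ∧ R2 ∧ R3 via Lemma 15's gap,
`integrable_of_R1_R2_R3`, analytic core `integrable_of_gap`). Serves the qed-hepp theory seat's GLOBAL CERTIFICATE THEOREM
`HOME/theory/BOUNDEDNESS.md` §5.8.2, whose condition (e) reads «Deg(ω) > 0 for every ω ∈ ℝ^N_{≥0} ∖ ℝ·1_E» with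
Deg(ω) = ⟨ω,1⟩ + val_ω(P) − Σ_k a_k val_ω(F_k) — in this file's letters (y = −ω, a = P·Π_e x_e with ν = 1, b_k = F_k with ρ_k = a_k) exactly
«Γ(y) > 0 for every y ∉ ℝ𝟙» —, and which concludes (c) «|f| ∈ L¹ of the Feynman simplex»: the step (e) ⇒ (c) is `integrable_of_faceValue_gap_pos`
below, up to the simplex ↔ affine-chart dictionary of `ConvergenceTheorem.lean` / `EuclideanFeynmanQuadrature.lean` (cell sheet
`HOME/lit/SOURCES.md` §12.B).

Source [Borinsky2020]: M. Borinsky, "Tropical Monte Carlo quadrature for Feynman integrals", Ann. Inst. Henri Poincaré D 10 (2023) 635–685 =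
arXiv:2008.12310v2 (LaTeX e-print held by the pub-qed cell; line numbers as in the companion headers). VERBATIM. **Theorem 3** (tex l.315–331):
"The integral in eq. (integral) is convergent if (R1) the denominator polytope ℬ is (n−1)-dimensional, (R2) the numerator polytope 𝒜 is
contained in the relative interior of ℬ: 𝒜 ⊂ relint ℬ, (R3) all the denominator polynomials {b_j} are completely non-vanishing on ℙ^{n−1}_{>0}."
**Remark 4** (l.333–337): "The condition in eq. (homogeneous) [Σ_i ν_i deg a_i = Σ_j ρ_j deg b_j] … guarantees that 𝒜 and ℬ both lie in the
same hyperplane 𝒜, ℬ ⊂ {v ∈ ℝⁿ : ⟨𝟙,v⟩ = ξ}". §4 after **eq. (atrbtr_exp)** (l.663–666): "Π_i a_i^tr(x)^{Re ν_i}/Π_j b_j^tr(x)^{Re ρ_j} =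
exp(max_{v∈𝒜}⟨y,v⟩ − max_{v∈ℬ}⟨y,v⟩) … If 𝒜 and ℬ fulfill the requirements R1 and R2 of Theorem 3, this exponent is falling sufficiently fast
for large y for the integral in eq. (integral) to be convergent." **Lemma 15** (l.669–676): "If 𝒜 and ℬ fulfill the requirements R1 and R2 of
Theorem 3, then there is a constant ε > 0 such that max_{v∈ℬ}⟨y,v⟩ − max_{v∈𝒜}⟨y,v⟩ ≥ ε‖y‖_{ℝⁿ/𝟙ℝ} for all y ∈ ℝⁿ/𝟙ℝ, where
‖y‖_{ℝⁿ/𝟙ℝ} = inf_{μ∈ℝ} ‖y + μ𝟙‖ is the norm on the quotient space". (l.339): "A similar theorem in the equivalent context of Euler-Mellin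
integrals was proven in [Nilsson–Passare] (see also [Berkesch–Forsgård–Passare])."

WHAT THIS FILE ADDS (READING, disclosed). Lemma 15's conclusion — the uniform gap — is the ONLY property of (𝒜, ℬ) that the convergence
proof uses (companion `integrable_of_gap`). For support functions of polytopes lying in a common hyperplane `⟨𝟙,·⟩ = ξ` (Remark 4) the uniform
gap is EQUIVALENT to its pointwise form "max_ℬ⟨y,·⟩ − max_𝒜⟨y,·⟩ > 0 for every y ∉ ℝ𝟙": the difference `Γ` is continuous, positively
homogeneous of degree one and invariant under `y ↦ y + μ𝟙`, so its minimum over the compact set `{‖y‖_∞ = 1, y_0 = 0}` is attained and positive,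
and every `y ∉ ℝ𝟙` rescales into that set (`exists_uniform_gap_of_pos`, [folklore] compactness; the converse `uniform ⇒ pointwise` is one line,
`pos_of_uniform_gap`). The pointwise form is how a RAY test reads Theorem 3 ("the leading exponent along every direction x = e^{−λω} is
positive"), and is the shape in which the qed-hepp certificate (BND 5.8.2 (e)) and the Euler–Mellin literature (Nilsson–Passare 2013 Thm 1:
`s ∈ int(t·Newt f)` ⟺ `⟨s,y⟩ < t·max_{Newt f}⟨y,·⟩` for all `y ≠ 0`) state the hypothesis. Typed for REAL exponents `ν_i, ρ_j ≥ 0` and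
homogeneous `a_i`, `b_j` with `Σ_i ν_i deg a_i = Σ_j ρ_j deg b_j` (eq. (homogeneous)), ambient dimension `n + 1`, chart `x_n = 1`, as in the
companion.

PROVED (0 named facts, D-0026; Mathlib + `TropicalApproximation` / `TropicalLowerBound` / `ConvergenceTheorem` only):
* support-function calculus: `pairing_smul`, `faceValue_smul_of_nonneg` (`max_{NP_p}⟨c·y,·⟩ = c·max_{NP_p}⟨y,·⟩`, `c ≥ 0`), `pairing_add_const`,
  `faceValue_add_const_of_isHomogeneous` (`max_{NP_p}⟨y + μ𝟙,·⟩ = max_{NP_p}⟨y,·⟩ + μ·deg p` for homogeneous `p ≠ 0` — Remark 4's hyperplane);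
* `exists_uniform_gap_of_pos` — for ANY `Γ : ℝ^{n+1} → ℝ` continuous, positively 1-homogeneous, 𝟙-invariant and positive off `ℝ𝟙`:
  `∃ ε > 0, ∀ y k k', ε (y_k − y_{k'}) ≤ Γ(y)` (the companion's coordinate form of "≥ ε‖y‖_{ℝⁿ/𝟙ℝ}"); `pos_of_uniform_gap` (converse);
* `gapFun_continuous`, `gapFun_smul`, `gapFun_add_const` — the three properties for `Γ = Σ_j ρ_j max_{supp b_j}⟨y,·⟩ − Σ_i ν_i max_{supp a_i}⟨y,·⟩`
  under eq. (homogeneous);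
* **`integrable_of_faceValue_gap_pos`** — Theorem 3 with (R1 ∧ R2) replaced by the pointwise gap: homogeneous `a_i ≠ 0`, `b_j`, eq. (homogeneous),
  `Γ(y) > 0` whenever `y` is not constant, and R3 ⇒ the integrand `Π_i |a_i(e^{(y,0)})|^{ν_i}/Π_j |b_j(e^{(y,0)})|^{ρ_j}` is Lebesgue-integrable on
  `ℝⁿ` (= `integrable_of_gap` ∘ `exists_uniform_gap_of_pos`); `integrableOn_of_faceValue_gap_pos` — the same in the Euler–Mellin coordinates
  `∫_{ℝⁿ_{>0}} (…)|_{x_n=1} Π dx_k/x_k`; `integrable_tropical_of_faceValue_gap_pos` — the R3-free envelope `I^tr < ∞`.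
NOT typed here: that R1 ∧ R2 ⇔ pointwise gap (only "R1 ∧ R2 ⇒ uniform gap" = Lemma 15 is in the companion, and "pointwise ⇔ uniform" here);
the converse of Theorem 3 (Nilsson–Passare necessity); fans / the sector sum of Theorem 19; the simplex form of the integral.
-/

noncomputable section

open MvPolynomial Finset Real MeasureTheory

namespace Literature.MathematicalPhysics.QuantumFieldTheory.Borinsky2020

/-! ### Scaling and `𝟙`-shift of the support function `y ↦ max_{ℓ ∈ supp p} ⟨y, ℓ⟩` -/

section SupportFunction

variable {σ : Type*}

/-- `⟨c·y, ℓ⟩ = c·⟨y, ℓ⟩`. [cite: Borinsky2020, §2 (tropical.tex l.291: "the usual scalar product")] -/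
theorem pairing_smul (c : ℝ) (y : σ → ℝ) (d : σ →₀ ℕ) : pairing (c • y) d = c * pairing y d := by
  simp only [pairing, Pi.smul_apply, smul_eq_mul, Finset.mul_sum, mul_assoc]

/-- Positive homogeneity of the support function of `NP_p`: `max_{ℓ∈supp p}⟨c·y, ℓ⟩ = c · max_{ℓ∈supp p}⟨y, ℓ⟩` for `c ≥ 0`.
[cite: Borinsky2020, Proposition 7 (tropical.tex l.425–428: p^tr(e^y) = e^{max⟨y,·⟩}); §2 (l.291)] -/
theorem faceValue_smul_of_nonneg {p : MvPolynomial σ ℝ} {c : ℝ} (hc : 0 ≤ c) (y : σ → ℝ) :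
    faceValue p (c • y) = c * faceValue p y := by
  by_cases hp : p = 0
  · simp [hp, faceValue]
  refine le_antisymm ?_ ?_
  · obtain ⟨d, hd, hdeq⟩ := exists_pairing_eq_faceValue hp (c • y)
    rw [← hdeq, pairing_smul]
    exact mul_le_mul_of_nonneg_left (pairing_le_faceValue hd y) hc
  · obtain ⟨d, hd, hdeq⟩ := exists_pairing_eq_faceValue hp y
    rw [← hdeq, ← pairing_smul]
    exact pairing_le_faceValue hd (c • y)

/-- `⟨y + μ𝟙, ℓ⟩ = ⟨y, ℓ⟩ + μ·|ℓ|`. [cite: Borinsky2020, §2 (tropical.tex l.291, l.299: "NP_p … is contained in the hyperplane {⟨𝟙,v⟩ = deg p}")] -/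
theorem pairing_add_const (y : σ → ℝ) (μ : ℝ) (d : σ →₀ ℕ) :
    pairing (fun i => y i + μ) d = pairing y d + μ * ∑ i ∈ d.support, (d i : ℝ) := by
  simp only [pairing, add_mul, Finset.sum_add_distrib, Finset.mul_sum]

/-- For a HOMOGENEOUS `p` of degree `N` and `ℓ ∈ supp p`: `⟨y + μ𝟙, ℓ⟩ = ⟨y, ℓ⟩ + μN` ("NP_p is contained in the hyperplane
{v : ⟨𝟙,v⟩ = deg p}"). [cite: Borinsky2020, §2 (tropical.tex l.299); Remark 4 (l.333–337)] -/
theorem pairing_add_const_of_isHomogeneous {p : MvPolynomial σ ℝ} {N : ℕ} (hp : p.IsHomogeneous N)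
    {d : σ →₀ ℕ} (hd : d ∈ p.support) (y : σ → ℝ) (μ : ℝ) :
    pairing (fun i => y i + μ) d = pairing y d + μ * N := by
  rw [pairing_add_const, ← Nat.cast_sum, ← hp.degree_eq_sum_deg_support hd]

/-- `𝟙`-shift of the support function of a HOMOGENEOUS `p ≠ 0` of degree `N`: `max_{supp p}⟨y + μ𝟙, ·⟩ = max_{supp p}⟨y, ·⟩ + μN`
(Remark 4: the Newton polytope lies in the hyperplane `⟨𝟙, v⟩ = deg p`). [cite: Borinsky2020, Remark 4 (tropical.tex l.333–337); §2 (l.299)] -/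
theorem faceValue_add_const_of_isHomogeneous {p : MvPolynomial σ ℝ} {N : ℕ} (hp : p.IsHomogeneous N) (hp0 : p ≠ 0)
    (y : σ → ℝ) (μ : ℝ) :
    faceValue p (fun i => y i + μ) = faceValue p y + μ * N := by
  refine le_antisymm ?_ ?_
  · obtain ⟨d, hd, hdeq⟩ := exists_pairing_eq_faceValue hp0 (fun i => y i + μ)
    rw [← hdeq, pairing_add_const_of_isHomogeneous hp hd]
    exact add_le_add (pairing_le_faceValue hd y) le_rfl
  · obtain ⟨d, hd, hdeq⟩ := exists_pairing_eq_faceValue hp0 y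
    rw [← hdeq, ← pairing_add_const_of_isHomogeneous hp hd]
    exact pairing_le_faceValue hd _

end SupportFunction

/-! ### Pointwise positivity off `ℝ𝟙` ⇔ the uniform gap of Lemma 15 (homogeneity + compactness) -/

section Compactness

variable {n : ℕ}

/-- **Uniform gap from pointwise positivity.** Let `Γ : ℝ^{n+1} → ℝ` be continuous, positively homogeneous of degree one
(`Γ(c·y) = c·Γ(y)`, `c ≥ 0`), invariant under `y ↦ y + μ𝟙`, and positive at every `y` that is not a multiple of `𝟙` (not all coordinates
equal). Then `∃ ε > 0, ∀ y k k', ε·(y_k − y_{k'}) ≤ Γ(y)` — the coordinate form of Lemma 15's "≥ ε‖y‖_{ℝⁿ/𝟙ℝ}" used by the companion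
`integrable_of_gap`. Proof: `Γ` attains a positive minimum `m` on the compact set `{‖y‖_∞ = 1, y_0 = 0}`; any `y` is `y' + y_0 𝟙` with
`y'_0 = 0`, `Γ(y) = Γ(y') = ‖y'‖·Γ(y'/‖y'‖) ≥ m‖y'‖ ≥ (m/2)(y_k − y_{k'})`. [folklore] (context: [cite: Borinsky2020, Lemma 15 (tropical.tex l.669–676)]) -/
theorem exists_uniform_gap_of_pos (Γ : (Fin (n + 1) → ℝ) → ℝ) (hΓc : Continuous Γ)
    (hhom : ∀ c : ℝ, 0 ≤ c → ∀ y, Γ (c • y) = c * Γ y)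
    (hinv : ∀ (μ : ℝ) (y : Fin (n + 1) → ℝ), Γ (fun k => y k + μ) = Γ y)
    (hpos : ∀ y : Fin (n + 1) → ℝ, (∃ k k', y k ≠ y k') → 0 < Γ y) :
    ∃ ε : ℝ, 0 < ε ∧ ∀ y : Fin (n + 1) → ℝ, ∀ k k', ε * (y k - y k') ≤ Γ y := by
  -- `Γ 0 = 0` and `Γ` vanishes on constants
  have hΓ0 : Γ 0 = 0 := by
    have h := hhom 0 le_rfl 0
    simpa using h
  have hΓconst : ∀ μ : ℝ, Γ (fun _ => μ) = 0 := by
    intro μ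
    have h := hinv μ 0
    simp only [Pi.zero_apply, zero_add] at h
    rw [h, hΓ0]
  -- `Γ ≥ 0` everywhere
  have hΓnn : ∀ y, 0 ≤ Γ y := by
    intro y
    by_cases hc : ∃ k k', y k ≠ y k'
    · exact (hpos y hc).le
    · push Not at hc
      have hy : y = fun _ => y 0 := funext fun k => hc k 0
      rw [hy, hΓconst]
  -- the reduction `y ↦ y' = y − y_0 𝟙`
  set red : (Fin (n + 1) → ℝ) → (Fin (n + 1) → ℝ) := fun y k => y k - y 0 with hred
  have hred_eq : ∀ y, Γ (red y) = Γ y := by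
    intro y
    have h := hinv (y 0) (red y)
    have h2 : (fun k => red y k + y 0) = y := funext fun k => by simp [hred]
    rw [h2] at h
    exact h.symm
  have hred_bound : ∀ y k k', y k - y k' ≤ 2 * ‖red y‖ := by
    intro y k k'
    have h1 : red y k ≤ ‖red y‖ := (le_abs_self _).trans (by rw [← Real.norm_eq_abs]; exact norm_le_pi_norm _ k)
    have h2 : -red y k' ≤ ‖red y‖ := (neg_le_abs _).trans (by rw [← Real.norm_eq_abs]; exact norm_le_pi_norm _ k')
    have h3 : y k - y k' = red y k - red y k' := by simp [hred]
    rw [h3]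
    linarith
  -- the compact set
  set K : Set (Fin (n + 1) → ℝ) := Metric.sphere 0 1 ∩ {y | y 0 = 0} with hK
  have hKc : IsCompact K :=
    (isCompact_sphere (0 : Fin (n + 1) → ℝ) 1).inter_right (isClosed_eq (continuous_apply 0) continuous_const)
  -- any nonconstant `y` rescales into `K`
  have hscale : ∀ y : Fin (n + 1) → ℝ, red y ≠ 0 → ‖red y‖⁻¹ • red y ∈ K := by
    intro y hy
    have hr : 0 < ‖red y‖ := norm_pos_iff.mpr hy
    refine ⟨?_, ?_⟩
    · rw [mem_sphere_zero_iff_norm, norm_smul, norm_inv, norm_norm, inv_mul_cancel₀ hr.ne']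
    · show ‖red y‖⁻¹ • red y 0 = 0
      simp [hred]
  by_cases hKne : K.Nonempty
  · obtain ⟨y₀, hy₀K, hmin⟩ := hKc.exists_isMinOn hKne hΓc.continuousOn
    -- the minimum is positive: `y₀` is not constant (`‖y₀‖ = 1`, `y₀ 0 = 0`)
    have hm : 0 < Γ y₀ := by
      refine hpos y₀ ?_
      by_contra hc
      push Not at hc
      have hy : y₀ = 0 := funext fun k => by rw [hc k 0, hy₀K.2]; rfl
      have h1 : ‖y₀‖ = 1 := mem_sphere_zero_iff_norm.mp hy₀K.1
      rw [hy, norm_zero] at h1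
      exact zero_ne_one h1
    refine ⟨Γ y₀ / 2, by positivity, fun y k k' => ?_⟩
    by_cases hy : red y = 0
    · -- constant `y`: both sides trivial
      have h3 : y k - y k' = red y k - red y k' := by simp [hred]
      rw [h3, hy]
      simp only [Pi.zero_apply, sub_self, mul_zero]
      exact hΓnn y
    · have hr : 0 < ‖red y‖ := norm_pos_iff.mpr hy
      have hmem := hscale y hy
      have hmin' : Γ y₀ ≤ Γ (‖red y‖⁻¹ • red y) := hmin hmem
      have hhom' : Γ (red y) = ‖red y‖ * Γ (‖red y‖⁻¹ • red y) := by
        have h := hhom ‖red y‖ hr.le (‖red y‖⁻¹ • red y)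
        rw [smul_smul, mul_inv_cancel₀ hr.ne', one_smul] at h
        exact h
      calc Γ y₀ / 2 * (y k - y k') ≤ Γ y₀ / 2 * (2 * ‖red y‖) :=
            mul_le_mul_of_nonneg_left (hred_bound y k k') (by positivity)
        _ = ‖red y‖ * Γ y₀ := by ring
        _ ≤ ‖red y‖ * Γ (‖red y‖⁻¹ • red y) := mul_le_mul_of_nonneg_left hmin' hr.le
        _ = Γ (red y) := hhom'.symm
        _ = Γ y := hred_eq y
  · -- `K` empty (only `n = 0`): every `y` is constant
    refine ⟨1, one_pos, fun y k k' => ?_⟩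
    have hy : red y = 0 := by
      by_contra hy
      exact hKne ⟨_, hscale y hy⟩
    have h3 : y k - y k' = red y k - red y k' := by simp [hred]
    rw [h3, hy]
    simp only [Pi.zero_apply, sub_self, mul_zero]
    exact hΓnn y

/-- The converse (trivial): a uniform gap gives pointwise positivity off `ℝ𝟙`. [cite: Borinsky2020, Lemma 15 (tropical.tex l.669–676)] -/
theorem pos_of_uniform_gap (Γ : (Fin (n + 1) → ℝ) → ℝ) {ε : ℝ} (hε : 0 < ε)
    (hgap : ∀ y : Fin (n + 1) → ℝ, ∀ k k', ε * (y k - y k') ≤ Γ y)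
    (y : Fin (n + 1) → ℝ) (hy : ∃ k k', y k ≠ y k') : 0 < Γ y := by
  obtain ⟨k, k', hkk'⟩ := hy
  rcases lt_or_gt_of_ne hkk' with h | h
  · exact lt_of_lt_of_le (mul_pos hε (sub_pos.mpr h)) (hgap y k' k)
  · exact lt_of_lt_of_le (mul_pos hε (sub_pos.mpr h)) (hgap y k k')

end Compactness

/-! ### The support-function difference `Γ = max_ℬ − max_𝒜` has the three properties under eq. (homogeneous) -/

section GapFunction

variable {m : ℕ} {ι κ : Type*} [Fintype ι] [Fintype κ]
  (a : ι → MvPolynomial (Fin m) ℝ) (b : κ → MvPolynomial (Fin m) ℝ) (ν : ι → ℝ) (ρ : κ → ℝ)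

/-- `Γ(y) = Σ_j ρ_j max_{supp b_j}⟨y,·⟩ − Σ_i ν_i max_{supp a_i}⟨y,·⟩` (= `max_ℬ⟨y,·⟩ − max_𝒜⟨y,·⟩`, eq. (atrbtr_exp)) is continuous.
[cite: Borinsky2020, eq. (atrbtr_exp) (tropical.tex l.663–666); Proposition 7] -/
theorem gapFun_continuous (ha : ∀ i, a i ≠ 0) (hb : ∀ j, b j ≠ 0) :
    Continuous fun y : Fin m → ℝ => (∑ j, ρ j * faceValue (b j) y) - ∑ i, ν i * faceValue (a i) y :=
  (continuous_finsetSum _ fun j _ => continuous_const.mul (continuous_faceValue (hb j))).sub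
    (continuous_finsetSum _ fun i _ => continuous_const.mul (continuous_faceValue (ha i)))

/-- `Γ` is positively homogeneous of degree one. [cite: Borinsky2020, eq. (atrbtr_exp) (tropical.tex l.663–666); §2 (l.291)] -/
theorem gapFun_smul (c : ℝ) (hc : 0 ≤ c) (y : Fin m → ℝ) :
    ((∑ j, ρ j * faceValue (b j) (c • y)) - ∑ i, ν i * faceValue (a i) (c • y)) =
      c * ((∑ j, ρ j * faceValue (b j) y) - ∑ i, ν i * faceValue (a i) y) := by
  simp only [faceValue_smul_of_nonneg hc, mul_sub, Finset.mul_sum]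
  congr 1 <;> exact Finset.sum_congr rfl fun _ _ => by ring

/-- `Γ` is invariant under `y ↦ y + μ𝟙` when the `a_i`, `b_j` are homogeneous with `Σ_i ν_i deg a_i = Σ_j ρ_j deg b_j`
(eq. (homogeneous) / Remark 4: `𝒜, ℬ ⊂ {⟨𝟙,v⟩ = ξ}`). [cite: Borinsky2020, Remark 4 (tropical.tex l.333–337); eq. (homogeneous) (l.229–233)] -/
theorem gapFun_add_const (ha : ∀ i, a i ≠ 0) (hb : ∀ j, b j ≠ 0) {da : ι → ℕ} {db : κ → ℕ}
    (hha : ∀ i, (a i).IsHomogeneous (da i)) (hhb : ∀ j, (b j).IsHomogeneous (db j))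
    (hdeg : ∑ i, ν i * da i = ∑ j, ρ j * db j) (μ : ℝ) (y : Fin m → ℝ) :
    ((∑ j, ρ j * faceValue (b j) (fun k => y k + μ)) - ∑ i, ν i * faceValue (a i) (fun k => y k + μ)) =
      (∑ j, ρ j * faceValue (b j) y) - ∑ i, ν i * faceValue (a i) y := by
  have hB : (∑ j, ρ j * faceValue (b j) (fun k => y k + μ)) = (∑ j, ρ j * faceValue (b j) y) + μ * ∑ j, ρ j * db j := by
    rw [Finset.mul_sum, ← Finset.sum_add_distrib]
    exact Finset.sum_congr rfl fun j _ => by rw [faceValue_add_const_of_isHomogeneous (hhb j) (hb j)]; ring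
  have hA : (∑ i, ν i * faceValue (a i) (fun k => y k + μ)) = (∑ i, ν i * faceValue (a i) y) + μ * ∑ i, ν i * da i := by
    rw [Finset.mul_sum, ← Finset.sum_add_distrib]
    exact Finset.sum_congr rfl fun i _ => by rw [faceValue_add_const_of_isHomogeneous (hha i) (ha i)]; ring
  rw [hB, hA, hdeg]
  ring

/-- Under eq. (homogeneous), pointwise positivity of `Γ` off `ℝ𝟙` is EQUIVALENT to the uniform gap of Lemma 15 (coordinate form).
[cite: Borinsky2020, Lemma 15 (tropical.tex l.669–676); Remark 4 (l.333–337)] -/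
theorem uniform_gap_iff_pos {n : ℕ} (a : ι → MvPolynomial (Fin (n + 1)) ℝ) (b : κ → MvPolynomial (Fin (n + 1)) ℝ)
    (ν : ι → ℝ) (ρ : κ → ℝ) (ha : ∀ i, a i ≠ 0) (hb : ∀ j, b j ≠ 0) {da : ι → ℕ} {db : κ → ℕ}
    (hha : ∀ i, (a i).IsHomogeneous (da i)) (hhb : ∀ j, (b j).IsHomogeneous (db j))
    (hdeg : ∑ i, ν i * da i = ∑ j, ρ j * db j) :
    (∃ ε : ℝ, 0 < ε ∧ ∀ y : Fin (n + 1) → ℝ, ∀ k k',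
        ε * (y k - y k') ≤ (∑ j, ρ j * faceValue (b j) y) - ∑ i, ν i * faceValue (a i) y) ↔
      ∀ y : Fin (n + 1) → ℝ, (∃ k k', y k ≠ y k') →
        0 < (∑ j, ρ j * faceValue (b j) y) - ∑ i, ν i * faceValue (a i) y := by
  constructor
  · rintro ⟨ε, hε, hgap⟩ y hy
    exact pos_of_uniform_gap _ hε hgap y hy
  · intro hpos
    obtain ⟨ε, hε, h⟩ := exists_uniform_gap_of_pos
      (fun y => (∑ j, ρ j * faceValue (b j) y) - ∑ i, ν i * faceValue (a i) y)
      (gapFun_continuous a b ν ρ ha hb) (fun c hc y => gapFun_smul a b ν ρ c hc y)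
      (fun μ y => gapFun_add_const a b ν ρ ha hb hha hhb hdeg μ y) hpos
    exact ⟨ε, hε, h⟩

end GapFunction

/-! ### Theorem 3 in pointwise-gap form -/

section PointwiseTheorem

variable {n : ℕ} {ι κ : Type*} [Fintype ι] [Fintype κ]

/-- **Theorem 3, pointwise (ray) form — the analytic statement.** Homogeneous numerators `a_i ≠ 0` and denominators `b_j` with real exponents
`ν_i, ρ_j ≥ 0` and `Σ_i ν_i deg a_i = Σ_j ρ_j deg b_j` (eq. (homogeneous)); every `b_j` completely non-vanishing on the open orthant (R3); and
the support-function difference `Γ(y) = max_ℬ⟨y,·⟩ − max_𝒜⟨y,·⟩` POSITIVE at every non-constant `y` (every direction of `ℝ^{n+1}/ℝ𝟙`). Then,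
in the chart `x_n = 1`, `x = e^y`, the integrand `Π_i |a_i(e^{(y,0)})|^{ν_i} / Π_j |b_j(e^{(y,0)})|^{ρ_j}` of eq. (integral) is Lebesgue-integrable
on `ℝⁿ`. (= `exists_uniform_gap_of_pos` + the companion's `integrable_of_gap`.)
[cite: Borinsky2020, Theorem 3 (tropical.tex l.315–331); Remark 4 (l.333–337); eq. (atrbtr_exp) and l.666; Lemma 15 (l.669–676); proof of Theorem 3 (l.855–858)] -/
theorem integrable_of_faceValue_gap_pos
    (a : ι → MvPolynomial (Fin (n + 1)) ℝ) (b : κ → MvPolynomial (Fin (n + 1)) ℝ) (ν : ι → ℝ) (ρ : κ → ℝ)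
    (ha : ∀ i, a i ≠ 0) (hν : ∀ i, 0 ≤ ν i) (hρ : ∀ j, 0 ≤ ρ j)
    {da : ι → ℕ} {db : κ → ℕ} (hha : ∀ i, (a i).IsHomogeneous (da i)) (hhb : ∀ j, (b j).IsHomogeneous (db j))
    (hdeg : ∑ i, ν i * da i = ∑ j, ρ j * db j)
    (hR3 : ∀ j, CompletelyNonVanishing (b j) {x | ∀ k, 0 < x k})
    (hpos : ∀ y : Fin (n + 1) → ℝ, (∃ k k', y k ≠ y k') →
      0 < (∑ j, ρ j * faceValue (b j) y) - ∑ i, ν i * faceValue (a i) y) :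
    Integrable (fun y : Fin n → ℝ =>
      (∏ i, |eval (fun k => exp (Fin.snoc (α := fun _ => ℝ) y 0 k)) (a i)| ^ ν i) /
        ∏ j, |eval (fun k => exp (Fin.snoc (α := fun _ => ℝ) y 0 k)) (b j)| ^ ρ j) := by
  have hbne : ∀ j, b j ≠ 0 := fun j h0 => by
    have h1 := hR3 j 0 (fun _ => 1) (fun _ => one_pos)
    simp [h0, trunc] at h1
  obtain ⟨ε, hε, hgap⟩ := (uniform_gap_iff_pos a b ν ρ ha hbne hha hhb hdeg).2 hpos
  exact integrable_of_gap a b ν ρ ha hν hρ hR3 hε hgap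

/-- **Theorem 3, pointwise form, in the coordinates of eq. (integral_euler_mellin)**: under the hypotheses of
`integrable_of_faceValue_gap_pos`, `x ↦ (Π_i |a_i(x,1)|^{ν_i}/Π_j |b_j(x,1)|^{ρ_j})·Π_k x_k⁻¹` is Lebesgue-integrable on the open orthant `ℝⁿ_{>0}`.
[cite: Borinsky2020, Theorem 3 (tropical.tex l.315–331); eq. (integral_euler_mellin) (l.237–241)] -/
theorem integrableOn_of_faceValue_gap_pos
    (a : ι → MvPolynomial (Fin (n + 1)) ℝ) (b : κ → MvPolynomial (Fin (n + 1)) ℝ) (ν : ι → ℝ) (ρ : κ → ℝ)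
    (ha : ∀ i, a i ≠ 0) (hν : ∀ i, 0 ≤ ν i) (hρ : ∀ j, 0 ≤ ρ j)
    {da : ι → ℕ} {db : κ → ℕ} (hha : ∀ i, (a i).IsHomogeneous (da i)) (hhb : ∀ j, (b j).IsHomogeneous (db j))
    (hdeg : ∑ i, ν i * da i = ∑ j, ρ j * db j)
    (hR3 : ∀ j, CompletelyNonVanishing (b j) {x | ∀ k, 0 < x k})
    (hpos : ∀ y : Fin (n + 1) → ℝ, (∃ k k', y k ≠ y k') →
      0 < (∑ j, ρ j * faceValue (b j) y) - ∑ i, ν i * faceValue (a i) y) :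
    IntegrableOn (fun x : Fin n → ℝ =>
      (∏ i, |eval (Fin.snoc (α := fun _ => ℝ) x 1) (a i)| ^ ν i) /
        (∏ j, |eval (Fin.snoc (α := fun _ => ℝ) x 1) (b j)| ^ ρ j) * ∏ k, (x k)⁻¹) {x | ∀ k, 0 < x k} := by
  refine (integrableOn_mul_prod_inv_iff_integrable_exp (fun x : Fin n → ℝ =>
    (∏ i, |eval (Fin.snoc (α := fun _ => ℝ) x 1) (a i)| ^ ν i) /
      ∏ j, |eval (Fin.snoc (α := fun _ => ℝ) x 1) (b j)| ^ ρ j)).2 ?_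
  simp only [snoc_exp_one]
  exact integrable_of_faceValue_gap_pos a b ν ρ ha hν hρ hha hhb hdeg hR3 hpos

/-- **`I^tr < ∞` in pointwise form** (no R3; only `a_i, b_j ≠ 0`): under eq. (homogeneous) and `Γ > 0` off `ℝ𝟙`, the tropically approximated
integrand `Π_i a_i^tr(e^{(y,0)})^{ν_i}/Π_j b_j^tr(e^{(y,0)})^{ρ_j} = e^{−Γ(y,0)}` is integrable on `ℝⁿ`.
[cite: Borinsky2020, eq. (integral_trop) (tropical.tex l.885–887); eq. (atrbtr_exp) (l.663–666); Lemma 15] -/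
theorem integrable_tropical_of_faceValue_gap_pos
    (a : ι → MvPolynomial (Fin (n + 1)) ℝ) (b : κ → MvPolynomial (Fin (n + 1)) ℝ) (ν : ι → ℝ) (ρ : κ → ℝ)
    (ha : ∀ i, a i ≠ 0) (hb : ∀ j, b j ≠ 0)
    {da : ι → ℕ} {db : κ → ℕ} (hha : ∀ i, (a i).IsHomogeneous (da i)) (hhb : ∀ j, (b j).IsHomogeneous (db j))
    (hdeg : ∑ i, ν i * da i = ∑ j, ρ j * db j)
    (hpos : ∀ y : Fin (n + 1) → ℝ, (∃ k k', y k ≠ y k') →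
      0 < (∑ j, ρ j * faceValue (b j) y) - ∑ i, ν i * faceValue (a i) y) :
    Integrable (fun y : Fin n → ℝ =>
      (∏ i, trop (a i) (fun k => exp (Fin.snoc (α := fun _ => ℝ) y 0 k)) ^ ν i) /
        ∏ j, trop (b j) (fun k => exp (Fin.snoc (α := fun _ => ℝ) y 0 k)) ^ ρ j) := by
  obtain ⟨ε, hε, hgap⟩ := (uniform_gap_iff_pos a b ν ρ ha hb hha hhb hdeg).2 hpos
  exact integrable_tropical_of_gap a b ν ρ ha hb hε hgap

end PointwiseTheorem

end Literature.MathematicalPhysics.QuantumFieldTheory.Borinsky2020
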